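import Literature.Computability.Cryptography.LayeredTriangleGraph
import Literature.Computability.Cryptography.GraphPathProblemsBounds
import HarnessLib

/-!
# The radius gadget graph: Negative Triangle as one Radius instance

The combinatorial core of the reduction Negative Triangle `≤₃` Radius of Abboud, Grandoni and
Vassilevska Williams (*Subcubic equivalences between graph centrality problems, APSP and diameter*,
SODA 2015, Lemma 2.3 / proof of Thm. 1.1; journal version ACM Trans. Algorithms 19 (2023), §2.2):
given an integer-weighted complete digraph `W` on `n` vertices with `|W u v| ≤ M`, and `Q = Θ(M)`
large enough, the digraph with four copies `I, J, K, L` of the vertex set, arcs `u_I → v_J`,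
`u_J → v_K`, `u_K → v_L` of weight `Q + W u v` (`u ≠ v`) and a node `y` with arcs `v_I → y` of weight
`3Q - 1` has radius `≤ 3Q - 1` iff `W` has a negative triangle: the centre must be some `s_I`, its
distance to `y` is exactly `3Q - 1`, and its distance to its own copy `s_L` is below `3Q` iff `s`
lies on a negative triangle ("The key observation is that a node `s_I` has distance at most … to every
node `t_L` (including `s_L`) if and only if `s` is in a negative triangle"). In print the remaining
distances from `s_I` are kept small by a *sparse* bit gadget (`Z ∪ O`) and a hub `x`, so as to
preserve the number of edges; the zoo problem `Radius c` of
`Literature.Computability.Cryptography.FGProblemZoo` takes full weight matrices, so this file uses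
the dense rendering with direct arcs `u_I → v_I`, `u_I → u_J`, `u_I → v_L` (`u ≠ v`) of weight `2Q`
instead (they are too heavy to create new walks of weight `< 3Q` into `s_L`).

* `radiusGadget W Q` on `Fin (4 * n + 1)`: vertex `ℓ n + a` is copy `ℓ ∈ {0, 1, 2, 3}` (`I, J, K, L`)
  of `a < n` (`vI a`, `vJ a`, `vK a`, `vL a`), vertex `4 n` is `y` (`vy n`); entries through the
  total extension `wx W` of `W` to `ℕ × ℕ`;
* nonnegative weights have no negative cycle (`hasNoNegativeCycle_of_nonneg`), so for `2M + 1 ≤ Q`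
  the gadget is a legitimate `Radius` instance (`radiusGadget_nonneg`,
  `hasNoNegativeCycle_radiusGadget`, `hasBoundedWeights_radiusGadget`);
* **`weightedRadius_radiusGadget_eq_iff`**: for `2M + 1 ≤ Q`,
  `weightedRadius (radiusGadget W Q) = 3Q - 1 ↔ HasNegativeTriangle W` (all `n`; for `n = 0` the
  graph is the single vertex `y` of radius `0`).

Everything here is proved (last-edge extraction `exists_last_edge_of_walkDistLE_ne_top` and the
CLRS recurrence from `Literature.Computability.Cryptography.LayeredTriangleGraph`).

## References

* A. Abboud, F. Grandoni, V. Vassilevska Williams, *Subcubic equivalences between graph centrality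
  problems, APSP and diameter*, Proc. SODA 2015, 1681–1697, Thm. 1.1 and Lemma 2.3 (Radius).
  doi:10.1137/1.9781611973730.112
* T. H. Cormen, C. E. Leiserson, R. L. Rivest, C. Stein, *Introduction to Algorithms*, 3rd ed.,
  §25.1 (the `(min,+)` recurrence).
-/

namespace Literature.Computability.Cryptography

open Matrix Tropical

/-! ### Nonnegative weights -/

section Nonneg

variable {ι : Type*} [Fintype ι] [DecidableEq ι] (G : Matrix ι ι (WithTop ℤ))
  (hG : ∀ u v, 0 ≤ G u v)
include hG

/-- With nonnegative weights every walk optimum is nonnegative (induction along the CLRS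
recurrence). [folklore] -/
theorem walkDistLE_nonneg : ∀ (k : ℕ) (u v : ι), 0 ≤ walkDistLE G k u v
  | 0, u, v => by
      rw [walkDistLE_zero_apply]
      split_ifs
      · exact le_rfl
      · exact le_top
  | k + 1, u, v => by
      rw [walkDistLE_succ_apply_holds G k u v]
      exact le_min (walkDistLE_nonneg k u v)
        (Finset.le_inf fun l _ => add_nonneg (walkDistLE_nonneg k u l) (hG l v))

/-- **A digraph with nonnegative weights has no negative cycle** (CLRS §24: with nonnegative weights
all shortest-path weights are well defined and `d(u, u) = 0`). [cite: CLRS2009, §25.1] -/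
theorem hasNoNegativeCycle_of_nonneg : HasNoNegativeCycle G := fun u => by
  refine le_antisymm ?_ (walkDistLE_nonneg G hG _ u u)
  have h := walkDistLE_antitone_holds G u u (Nat.zero_le (Fintype.card ι))
  change walkDistLE G (Fintype.card ι) u u ≤ walkDistLE G 0 u u at h
  rw [walkDistLE_zero_apply, if_pos rfl] at h
  exact h

/-- **Lower bound through the in-arcs of the target.** With nonnegative weights, a walk optimum
between distinct vertices is at least any common lower bound `m` of the arcs entering the target
(peel off the last arc; the prefix is nonnegative). [folklore] -/
theorem le_walkDistLE_of_forall_arc_ge {m : WithTop ℤ} {v : ι} (hm : ∀ l, G l v ≠ ⊤ → m ≤ G l v)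
    {k : ℕ} {u : ι} (huv : u ≠ v) : m ≤ walkDistLE G k u v := by
  by_cases h : walkDistLE G k u v = ⊤
  · rw [h]; exact le_top
  obtain ⟨k', -, l, he, -, ha⟩ := exists_last_edge_of_walkDistLE_ne_top G h huv
  rw [he]
  calc m ≤ G l v := hm l ha
    _ = 0 + G l v := (zero_add _).symm
    _ ≤ walkDistLE G k' u l + G l v := add_le_add (walkDistLE_nonneg G hG k' u l) le_rfl

/-- **Peeling the last arc under a strict upper bound.** With nonnegative weights, if the optimum
from `u` to `v ≠ u` is `< B`, then it splits as a finite, nonnegative prefix optimum to some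
in-neighbour `l` of `v` plus the genuine arc `l → v`. [folklore] -/
theorem exists_last_arc_of_walkDistLE_lt {k : ℕ} {u v : ι} {B : WithTop ℤ}
    (hlt : walkDistLE G k u v < B) (huv : u ≠ v) :
    ∃ k' < k, ∃ l, walkDistLE G k u v = walkDistLE G k' u l + G l v ∧
      walkDistLE G k' u l ≠ ⊤ ∧ G l v ≠ ⊤ ∧ 0 ≤ walkDistLE G k' u l := by
  have h : walkDistLE G k u v ≠ ⊤ := fun h => by rw [h] at hlt; exact not_top_lt hlt
  obtain ⟨k', hk', l, he, hf, ha⟩ := exists_last_edge_of_walkDistLE_ne_top G h huv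
  exact ⟨k', hk', l, he, hf, ha, walkDistLE_nonneg G hG k' u l⟩

end Nonneg

/-! ### The gadget -/

section Gadget

variable {n : ℕ}

/-- The total extension of an `n × n` integer matrix to `ℕ × ℕ` (`0` outside the range), so that the
gadget can be written by arithmetic on vertex numbers. [folklore] -/
def wx (W : Matrix (Fin n) (Fin n) ℤ) (a b : ℕ) : ℤ :=
  if h : a < n ∧ b < n then W ⟨a, h.1⟩ ⟨b, h.2⟩ else 0

/-- `wx` on genuine indices. [folklore] -/
theorem wx_eq (W : Matrix (Fin n) (Fin n) ℤ) (a b : Fin n) : wx W a b = W a b := by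
  unfold wx
  rw [dif_pos ⟨a.is_lt, b.is_lt⟩]

/-- `wx` on numbers below `n`. [folklore] -/
theorem wx_mk (W : Matrix (Fin n) (Fin n) ℤ) {a b : ℕ} (ha : a < n) (hb : b < n) :
    wx W a b = W ⟨a, ha⟩ ⟨b, hb⟩ := by
  unfold wx
  rw [dif_pos ⟨ha, hb⟩]

/-- `wx` inherits the weight bound of `W` (and is `0` elsewhere). [folklore] -/
theorem abs_wx_le (W : Matrix (Fin n) (Fin n) ℤ) {M : ℕ} (hW : ∀ a b, |W a b| ≤ M) (a b : ℕ) :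
    |wx W a b| ≤ M := by
  unfold wx
  split_ifs
  · exact hW _ _
  · simp

/-- Copy `I` (layer `0`) of vertex `a`. [folklore] -/
def vI (a : Fin n) : Fin (4 * n + 1) := ⟨a, by omega⟩
/-- Copy `J` (layer `1`) of vertex `a`. [folklore] -/
def vJ (a : Fin n) : Fin (4 * n + 1) := ⟨n + a, by omega⟩
/-- Copy `K` (layer `2`) of vertex `a`. [folklore] -/
def vK (a : Fin n) : Fin (4 * n + 1) := ⟨2 * n + a, by omega⟩
/-- Copy `L` (layer `3`) of vertex `a`. [folklore] -/
def vL (a : Fin n) : Fin (4 * n + 1) := ⟨3 * n + a, by omega⟩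
/-- The node `y` (vertex number `4 n`). [folklore] -/
def vy (n : ℕ) : Fin (4 * n + 1) := ⟨4 * n, by omega⟩

/-- The number of `vI a`. [folklore] -/
@[simp] theorem vI_val (a : Fin n) : (vI a : ℕ) = a := rfl
/-- The number of `vJ a`. [folklore] -/
@[simp] theorem vJ_val (a : Fin n) : (vJ a : ℕ) = n + a := rfl
/-- The number of `vK a`. [folklore] -/
@[simp] theorem vK_val (a : Fin n) : (vK a : ℕ) = 2 * n + a := rfl
/-- The number of `vL a`. [folklore] -/
@[simp] theorem vL_val (a : Fin n) : (vL a : ℕ) = 3 * n + a := rfl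
/-- The number of `vy n`. [folklore] -/
@[simp] theorem vy_val (n : ℕ) : (vy n : ℕ) = 4 * n := rfl

/-- Every vertex of `Fin (4 n + 1)` is a copy of some `a < n` or the node `y`. [folklore] -/
theorem gadgetVertex_cases (t : Fin (4 * n + 1)) :
    (∃ a : Fin n, t = vI a) ∨ (∃ a : Fin n, t = vJ a) ∨ (∃ a : Fin n, t = vK a) ∨
      (∃ a : Fin n, t = vL a) ∨ t = vy n := by
  obtain ⟨t, ht⟩ := t
  by_cases h1 : t < n
  · exact Or.inl ⟨⟨t, h1⟩, rfl⟩
  by_cases h2 : t < 2 * n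
  · exact Or.inr (Or.inl ⟨⟨t - n, by omega⟩, Fin.ext (by simp only [vJ_val]; omega)⟩)
  by_cases h3 : t < 3 * n
  · exact Or.inr (Or.inr (Or.inl ⟨⟨t - 2 * n, by omega⟩, Fin.ext (by simp only [vK_val]; omega)⟩))
  by_cases h4 : t < 4 * n
  · exact Or.inr (Or.inr (Or.inr (Or.inl ⟨⟨t - 3 * n, by omega⟩,
      Fin.ext (by simp only [vL_val]; omega)⟩)))
  · exact Or.inr (Or.inr (Or.inr (Or.inr (Fin.ext (by simp only [vy_val]; omega)))))

/-- **The entries of the radius gadget** on vertex numbers `a, b < 4 n + 1` (layer `ℓ` copy of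
`v < n` is `ℓ n + v`, `ℓ = 0, 1, 2, 3` for `I, J, K, L`; `4 n` is the node `y`): arcs `u_I → v_I`
(`u ≠ v`) of weight `2Q`; `u_I → v_J` of weight `Q + W u v` (`u ≠ v`) and `2Q` (`u = v`);
`u_J → v_K` and `u_K → v_L` (`u ≠ v`) of weight `Q + W u v`; `u_I → v_L` (`u ≠ v`) of weight `2Q`;
`u_I → y` of weight `3Q - 1`; no other arcs. The dense rendering of the gadget of
Abboud–Grandoni–Vassilevska Williams, SODA 2015, Lemma 2.3 (see the module docstring).
[cite: AbboudGrandoniVassilevskaWilliams2015, Lemma 2.3 (proof of Thm. 1.1)] -/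
def radiusGadgetEntry (W : Matrix (Fin n) (Fin n) ℤ) (Q : ℕ) (a b : ℕ) : WithTop ℤ :=
  if a < n then
    if b < n then (if a = b then ⊤ else ((2 * (Q : ℤ) : ℤ) : WithTop ℤ))
    else if b < 2 * n then
      (if a + n = b then ((2 * (Q : ℤ) : ℤ) : WithTop ℤ)
        else (((Q : ℤ) + wx W a (b - n) : ℤ) : WithTop ℤ))
    else if b < 3 * n then ⊤
    else if b < 4 * n then (if a + 3 * n = b then ⊤ else ((2 * (Q : ℤ) : ℤ) : WithTop ℤ))
    else ((3 * (Q : ℤ) - 1 : ℤ) : WithTop ℤ)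
  else if a < 2 * n then
    (if 2 * n ≤ b ∧ b < 3 * n ∧ a + n ≠ b then (((Q : ℤ) + wx W (a - n) (b - 2 * n) : ℤ) : WithTop ℤ)
      else ⊤)
  else if a < 3 * n then
    (if 3 * n ≤ b ∧ b < 4 * n ∧ a + n ≠ b then
        (((Q : ℤ) + wx W (a - 2 * n) (b - 3 * n) : ℤ) : WithTop ℤ)
      else ⊤)
  else ⊤

/-- **The radius gadget graph** of an integer-weighted complete digraph `W` on `Fin n` with the
weight parameter `Q`: the weighted digraph on `Fin (4 * n + 1)` with entries `radiusGadgetEntry`.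
[cite: AbboudGrandoniVassilevskaWilliams2015, Lemma 2.3 (proof of Thm. 1.1)] -/
def radiusGadget (W : Matrix (Fin n) (Fin n) ℤ) (Q : ℕ) :
    Matrix (Fin (4 * n + 1)) (Fin (4 * n + 1)) (WithTop ℤ) :=
  Matrix.of fun u v => radiusGadgetEntry W Q u v

variable (W : Matrix (Fin n) (Fin n) ℤ) (Q : ℕ)

/-- Entries of the radius gadget (definition unfolding). [folklore] -/
theorem radiusGadget_apply (u v : Fin (4 * n + 1)) :
    radiusGadget W Q u v = radiusGadgetEntry W Q u v :=
  rfl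

/-! #### The arcs, read forwards -/

/-- The arc `u_I → v_I` (`u ≠ v`) has weight `2Q`. [folklore] -/
theorem radiusGadgetEntry_II {u v : ℕ} (hu : u < n) (hv : v < n) (huv : u ≠ v) :
    radiusGadgetEntry W Q u v = ((2 * (Q : ℤ) : ℤ) : WithTop ℤ) := by
  unfold radiusGadgetEntry
  rw [if_pos hu, if_pos hv, if_neg huv]

/-- The arc `u_I → v_J` (`u ≠ v`) has weight `Q + W u v`. [folklore] -/
theorem radiusGadgetEntry_IJ {u v : ℕ} (hu : u < n) (hv : v < n) (huv : u ≠ v) :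
    radiusGadgetEntry W Q u (n + v) = (((Q : ℤ) + wx W u v : ℤ) : WithTop ℤ) := by
  unfold radiusGadgetEntry
  rw [if_pos hu, if_neg (by omega), if_pos (by omega), if_neg (by omega), Nat.add_sub_cancel_left]

/-- The arc `u_I → u_J` has weight `2Q`. [folklore] -/
theorem radiusGadgetEntry_IJ_self {u : ℕ} (hu : u < n) :
    radiusGadgetEntry W Q u (n + u) = ((2 * (Q : ℤ) : ℤ) : WithTop ℤ) := by
  unfold radiusGadgetEntry
  rw [if_pos hu, if_neg (by omega), if_pos (by omega), if_pos (by omega)]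

/-- The arc `u_J → v_K` (`u ≠ v`) has weight `Q + W u v`. [folklore] -/
theorem radiusGadgetEntry_JK {u v : ℕ} (hu : u < n) (hv : v < n) (huv : u ≠ v) :
    radiusGadgetEntry W Q (n + u) (2 * n + v) = (((Q : ℤ) + wx W u v : ℤ) : WithTop ℤ) := by
  unfold radiusGadgetEntry
  rw [if_neg (by omega), if_pos (by omega), if_pos ⟨by omega, by omega, by omega⟩,
    Nat.add_sub_cancel_left, Nat.add_sub_cancel_left]

/-- The arc `u_K → v_L` (`u ≠ v`) has weight `Q + W u v`. [folklore] -/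
theorem radiusGadgetEntry_KL {u v : ℕ} (hu : u < n) (hv : v < n) (huv : u ≠ v) :
    radiusGadgetEntry W Q (2 * n + u) (3 * n + v) = (((Q : ℤ) + wx W u v : ℤ) : WithTop ℤ) := by
  unfold radiusGadgetEntry
  rw [if_neg (by omega), if_neg (by omega), if_pos (by omega), if_pos ⟨by omega, by omega, by omega⟩,
    Nat.add_sub_cancel_left, Nat.add_sub_cancel_left]

/-- The arc `u_I → v_L` (`u ≠ v`) has weight `2Q`. [folklore] -/
theorem radiusGadgetEntry_IL {u v : ℕ} (hu : u < n) (hv : v < n) (huv : u ≠ v) :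
    radiusGadgetEntry W Q u (3 * n + v) = ((2 * (Q : ℤ) : ℤ) : WithTop ℤ) := by
  unfold radiusGadgetEntry
  rw [if_pos hu, if_neg (by omega), if_neg (by omega), if_neg (by omega), if_pos (by omega),
    if_neg (by omega)]

/-- The arc `u_I → y` has weight `3Q - 1`. [folklore] -/
theorem radiusGadgetEntry_Iy {u : ℕ} (hu : u < n) :
    radiusGadgetEntry W Q u (4 * n) = ((3 * (Q : ℤ) - 1 : ℤ) : WithTop ℤ) := by
  unfold radiusGadgetEntry
  rw [if_pos hu, if_neg (by omega), if_neg (by omega), if_neg (by omega), if_neg (by omega)]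

/-- `radiusGadget W Q (vI u) (vI v) = 2Q` for `u ≠ v`. [folklore] -/
theorem radiusGadget_II {u v : Fin n} (huv : u ≠ v) :
    radiusGadget W Q (vI u) (vI v) = ((2 * (Q : ℤ) : ℤ) : WithTop ℤ) := by
  rw [radiusGadget_apply, vI_val, vI_val]
  exact radiusGadgetEntry_II W Q u.is_lt v.is_lt fun h => huv (Fin.ext h)

/-- `radiusGadget W Q (vI u) (vJ v) = Q + W u v` for `u ≠ v`. [folklore] -/
theorem radiusGadget_IJ {u v : Fin n} (huv : u ≠ v) :
    radiusGadget W Q (vI u) (vJ v) = (((Q : ℤ) + W u v : ℤ) : WithTop ℤ) := by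
  rw [radiusGadget_apply, vI_val, vJ_val,
    radiusGadgetEntry_IJ W Q u.is_lt v.is_lt (fun h => huv (Fin.ext h)), wx_eq]

/-- `radiusGadget W Q (vI u) (vJ u) = 2Q`. [folklore] -/
theorem radiusGadget_IJ_self (u : Fin n) :
    radiusGadget W Q (vI u) (vJ u) = ((2 * (Q : ℤ) : ℤ) : WithTop ℤ) := by
  rw [radiusGadget_apply, vI_val, vJ_val, radiusGadgetEntry_IJ_self W Q u.is_lt]

/-- `radiusGadget W Q (vJ u) (vK v) = Q + W u v` for `u ≠ v`. [folklore] -/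
theorem radiusGadget_JK {u v : Fin n} (huv : u ≠ v) :
    radiusGadget W Q (vJ u) (vK v) = (((Q : ℤ) + W u v : ℤ) : WithTop ℤ) := by
  rw [radiusGadget_apply, vJ_val, vK_val,
    radiusGadgetEntry_JK W Q u.is_lt v.is_lt (fun h => huv (Fin.ext h)), wx_eq]

/-- `radiusGadget W Q (vK u) (vL v) = Q + W u v` for `u ≠ v`. [folklore] -/
theorem radiusGadget_KL {u v : Fin n} (huv : u ≠ v) :
    radiusGadget W Q (vK u) (vL v) = (((Q : ℤ) + W u v : ℤ) : WithTop ℤ) := by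
  rw [radiusGadget_apply, vK_val, vL_val,
    radiusGadgetEntry_KL W Q u.is_lt v.is_lt (fun h => huv (Fin.ext h)), wx_eq]

/-- `radiusGadget W Q (vI u) (vL v) = 2Q` for `u ≠ v`. [folklore] -/
theorem radiusGadget_IL {u v : Fin n} (huv : u ≠ v) :
    radiusGadget W Q (vI u) (vL v) = ((2 * (Q : ℤ) : ℤ) : WithTop ℤ) := by
  rw [radiusGadget_apply, vI_val, vL_val,
    radiusGadgetEntry_IL W Q u.is_lt v.is_lt (fun h => huv (Fin.ext h))]

/-- `radiusGadget W Q (vI u) (vy n) = 3Q - 1`. [folklore] -/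
theorem radiusGadget_Iy (u : Fin n) :
    radiusGadget W Q (vI u) (vy n) = ((3 * (Q : ℤ) - 1 : ℤ) : WithTop ℤ) := by
  rw [radiusGadget_apply, vI_val, vy_val, radiusGadgetEntry_Iy W Q u.is_lt]

/-! #### The arcs, read backwards (in-neighbours) -/

/-- **In-neighbours of `I`**: an arc into `v_I` comes from some `u_I`, `u ≠ v`, with weight `2Q`.
[folklore] -/
theorem radiusGadgetEntry_ne_top_tgt_I {a b : ℕ} (hb : b < n) (h : radiusGadgetEntry W Q a b ≠ ⊤) :
    a < n ∧ a ≠ b ∧ radiusGadgetEntry W Q a b = ((2 * (Q : ℤ) : ℤ) : WithTop ℤ) := by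
  unfold radiusGadgetEntry at h ⊢
  by_cases ha : a < n
  · rw [if_pos ha, if_pos hb] at h ⊢
    by_cases hab : a = b
    · rw [if_pos hab] at h; exact absurd rfl h
    · rw [if_neg hab]; exact ⟨ha, hab, rfl⟩
  · exfalso
    rw [if_neg ha] at h
    by_cases ha2 : a < 2 * n
    · rw [if_pos ha2, if_neg (by omega)] at h; exact h rfl
    · rw [if_neg ha2] at h
      by_cases ha3 : a < 3 * n
      · rw [if_pos ha3, if_neg (by omega)] at h; exact h rfl
      · rw [if_neg ha3] at h; exact h rfl

/-- **In-neighbours of `J`**: an arc into `v_J` comes from some `u_I`, with weight `2Q` if `u = v`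
and `Q + W u v` otherwise. [folklore] -/
theorem radiusGadgetEntry_ne_top_tgt_J {a v : ℕ} (hv : v < n)
    (h : radiusGadgetEntry W Q a (n + v) ≠ ⊤) :
    a < n ∧ ((a = v ∧ radiusGadgetEntry W Q a (n + v) = ((2 * (Q : ℤ) : ℤ) : WithTop ℤ)) ∨
      (a ≠ v ∧ radiusGadgetEntry W Q a (n + v) = (((Q : ℤ) + wx W a v : ℤ) : WithTop ℤ))) := by
  by_cases ha : a < n
  · refine ⟨ha, ?_⟩
    by_cases hav : a = v
    · subst hav; exact Or.inl ⟨rfl, radiusGadgetEntry_IJ_self W Q ha⟩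
    · exact Or.inr ⟨hav, radiusGadgetEntry_IJ W Q ha hv hav⟩
  · exfalso
    unfold radiusGadgetEntry at h
    rw [if_neg ha] at h
    by_cases ha2 : a < 2 * n
    · rw [if_pos ha2, if_neg (by omega)] at h; exact h rfl
    · rw [if_neg ha2] at h
      by_cases ha3 : a < 3 * n
      · rw [if_pos ha3, if_neg (by omega)] at h; exact h rfl
      · rw [if_neg ha3] at h; exact h rfl

/-- **In-neighbours of `K`**: an arc into `v_K` comes from some `u_J`, `u ≠ v`, with weight
`Q + W u v`. [folklore] -/
theorem radiusGadgetEntry_ne_top_tgt_K {a v : ℕ} (hv : v < n)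
    (h : radiusGadgetEntry W Q a (2 * n + v) ≠ ⊤) :
    ∃ u, u < n ∧ a = n + u ∧ u ≠ v ∧
      radiusGadgetEntry W Q a (2 * n + v) = (((Q : ℤ) + wx W u v : ℤ) : WithTop ℤ) := by
  unfold radiusGadgetEntry at h
  by_cases ha : a < n
  · exfalso
    rw [if_pos ha, if_neg (by omega), if_neg (by omega), if_pos (by omega)] at h
    exact h rfl
  · rw [if_neg ha] at h
    by_cases ha2 : a < 2 * n
    · rw [if_pos ha2] at h
      by_cases hc : 2 * n ≤ 2 * n + v ∧ 2 * n + v < 3 * n ∧ a + n ≠ 2 * n + v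
      · refine ⟨a - n, by omega, by omega, by omega, ?_⟩
        have := radiusGadgetEntry_JK W Q (u := a - n) (v := v) (by omega) hv (by omega)
        rwa [show n + (a - n) = a by omega] at this
      · rw [if_neg hc] at h; exact absurd rfl h
    · exfalso
      rw [if_neg ha2] at h
      by_cases ha3 : a < 3 * n
      · rw [if_pos ha3, if_neg (by omega)] at h; exact h rfl
      · rw [if_neg ha3] at h; exact h rfl

/-- **In-neighbours of `L`**: an arc into `v_L` comes either from some `u_I`, `u ≠ v`, with weight
`2Q`, or from some `u_K`, `u ≠ v`, with weight `Q + W u v`. [folklore] -/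
theorem radiusGadgetEntry_ne_top_tgt_L {a v : ℕ} (hv : v < n)
    (h : radiusGadgetEntry W Q a (3 * n + v) ≠ ⊤) :
    (a < n ∧ a ≠ v ∧ radiusGadgetEntry W Q a (3 * n + v) = ((2 * (Q : ℤ) : ℤ) : WithTop ℤ)) ∨
      ∃ u, u < n ∧ a = 2 * n + u ∧ u ≠ v ∧
        radiusGadgetEntry W Q a (3 * n + v) = (((Q : ℤ) + wx W u v : ℤ) : WithTop ℤ) := by
  by_cases ha : a < n
  · left
    by_cases hav : a = v
    · exfalso
      unfold radiusGadgetEntry at h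
      rw [if_pos ha, if_neg (by omega), if_neg (by omega), if_neg (by omega), if_pos (by omega),
        if_pos (by omega)] at h
      exact h rfl
    · exact ⟨ha, hav, radiusGadgetEntry_IL W Q ha hv hav⟩
  · right
    unfold radiusGadgetEntry at h
    rw [if_neg ha] at h
    by_cases ha2 : a < 2 * n
    · exfalso
      rw [if_pos ha2, if_neg (by omega)] at h; exact h rfl
    · rw [if_neg ha2] at h
      by_cases ha3 : a < 3 * n
      · rw [if_pos ha3] at h
        by_cases hc : 3 * n ≤ 3 * n + v ∧ 3 * n + v < 4 * n ∧ a + n ≠ 3 * n + v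
        · refine ⟨a - 2 * n, by omega, by omega, by omega, ?_⟩
          have := radiusGadgetEntry_KL W Q (u := a - 2 * n) (v := v) (by omega) hv (by omega)
          rwa [show 2 * n + (a - 2 * n) = a by omega] at this
        · rw [if_neg hc] at h; exact absurd rfl h
      · exfalso
        rw [if_neg ha3] at h; exact h rfl

/-- **In-neighbours of `y`**: an arc into `y` comes from some `u_I`, with weight `3Q - 1`.
[folklore] -/
theorem radiusGadgetEntry_ne_top_tgt_y {a : ℕ} (h : radiusGadgetEntry W Q a (4 * n) ≠ ⊤) :
    a < n ∧ radiusGadgetEntry W Q a (4 * n) = ((3 * (Q : ℤ) - 1 : ℤ) : WithTop ℤ) := by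
  by_cases ha : a < n
  · exact ⟨ha, radiusGadgetEntry_Iy W Q ha⟩
  · exfalso
    unfold radiusGadgetEntry at h
    rw [if_neg ha] at h
    by_cases ha2 : a < 2 * n
    · rw [if_pos ha2, if_neg (by omega)] at h; exact h rfl
    · rw [if_neg ha2] at h
      by_cases ha3 : a < 3 * n
      · rw [if_pos ha3, if_neg (by omega)] at h; exact h rfl
      · rw [if_neg ha3] at h; exact h rfl

/-! #### Weight range -/

/-- **Every arc of the gadget is one of `2Q`, `3Q - 1`, `Q + W u v`.** [folklore] -/
theorem radiusGadgetEntry_cases (a b : ℕ) :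
    radiusGadgetEntry W Q a b = ⊤ ∨ radiusGadgetEntry W Q a b = ((2 * (Q : ℤ) : ℤ) : WithTop ℤ) ∨
      radiusGadgetEntry W Q a b = ((3 * (Q : ℤ) - 1 : ℤ) : WithTop ℤ) ∨
      ∃ u v, radiusGadgetEntry W Q a b = (((Q : ℤ) + wx W u v : ℤ) : WithTop ℤ) := by
  unfold radiusGadgetEntry
  split_ifs <;> first
    | exact Or.inl rfl
    | exact Or.inr (Or.inl rfl)
    | exact Or.inr (Or.inr (Or.inl rfl))
    | exact Or.inr (Or.inr (Or.inr ⟨_, _, rfl⟩))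

variable {W Q} {M : ℕ}

/-- With `|W| ≤ M` and `2M + 1 ≤ Q`, every arc of the gadget is at least `Q - M ≥ 0`. [folklore] -/
theorem sub_le_radiusGadgetEntry (hW : ∀ a b, |W a b| ≤ M) (hQ : 2 * M + 1 ≤ Q) {a b : ℕ}
    (h : radiusGadgetEntry W Q a b ≠ ⊤) :
    (((Q : ℤ) - M : ℤ) : WithTop ℤ) ≤ radiusGadgetEntry W Q a b := by
  rcases radiusGadgetEntry_cases W Q a b with h' | h' | h' | ⟨u, v, h'⟩
  · exact absurd h' h
  · rw [h']; exact WithTop.coe_le_coe.2 (by omega)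
  · rw [h']; exact WithTop.coe_le_coe.2 (by omega)
  · rw [h']
    have := abs_wx_le W hW u v
    rw [abs_le] at this
    exact WithTop.coe_le_coe.2 (by omega)

/-- With `|W| ≤ M` and `2M + 1 ≤ Q`, the gadget has nonnegative weights. [folklore] -/
theorem radiusGadget_nonneg (hW : ∀ a b, |W a b| ≤ M) (hQ : 2 * M + 1 ≤ Q) (u v : Fin (4 * n + 1)) :
    0 ≤ radiusGadget W Q u v := by
  rw [radiusGadget_apply]
  by_cases h : radiusGadgetEntry W Q u v = ⊤
  · rw [h]; exact le_top
  · refine le_trans ?_ (sub_le_radiusGadgetEntry hW hQ h)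
    rw [← WithTop.coe_zero]
    exact WithTop.coe_le_coe.2 (by omega)

/-- **The gadget is a legitimate Radius/APSP instance**: no negative cycle. [folklore] -/
theorem hasNoNegativeCycle_radiusGadget (hW : ∀ a b, |W a b| ≤ M) (hQ : 2 * M + 1 ≤ Q) :
    HasNoNegativeCycle (radiusGadget W Q) :=
  hasNoNegativeCycle_of_nonneg _ (radiusGadget_nonneg hW hQ)

/-- **Weight range of the gadget**: with `|W| ≤ M` and `2M + 1 ≤ Q`, all weights lie in `[-3Q, 3Q]`
(indeed in `[Q - M, 3Q - 1]`). [folklore] -/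
theorem hasBoundedWeights_radiusGadget (hW : ∀ a b, |W a b| ≤ M) (hQ : 2 * M + 1 ≤ Q) :
    HasBoundedWeights (radiusGadget W Q) (3 * Q) := by
  intro u v
  rw [radiusGadget_apply]
  rcases radiusGadgetEntry_cases W Q u v with h' | h' | h' | ⟨a, b, h'⟩
  · exact Or.inl h'
  · refine Or.inr ⟨2 * (Q : ℤ), h', ?_⟩
    rw [abs_le]; constructor <;> omega
  · refine Or.inr ⟨3 * (Q : ℤ) - 1, h', ?_⟩
    rw [abs_le]; constructor <;> omega
  · refine Or.inr ⟨(Q : ℤ) + wx W a b, h', ?_⟩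
    have := abs_wx_le W hW a b
    rw [abs_le] at this ⊢
    constructor <;> omega

end Gadget

/-! ### Distances in the gadget -/

section Distances

variable {n : ℕ} {W : Matrix (Fin n) (Fin n) ℤ} {Q M : ℕ}

/-- **`I` is unreachable from outside `I`**: a finite walk optimum into a vertex of `I` starts in
`I`. [folklore] -/
theorem lt_of_walkDistLE_ne_top_tgt_I :
    ∀ (k : ℕ) (u v : Fin (4 * n + 1)), (v : ℕ) < n → walkDistLE (radiusGadget W Q) k u v ≠ ⊤ →
      (u : ℕ) < n
  | 0, u, v, hv, h => by
      rw [walkDistLE_zero_apply] at h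
      by_cases huv : u = v
      · rw [huv]; exact hv
      · rw [if_neg huv] at h; exact absurd rfl h
  | k + 1, u, v, hv, h => by
      rcases walkDistLE_succ_ne_top (radiusGadget W Q) h with ⟨-, hk⟩ | ⟨l, -, hl, hlv⟩
      · exact lt_of_walkDistLE_ne_top_tgt_I k u v hv hk
      · rw [radiusGadget_apply] at hlv
        exact lt_of_walkDistLE_ne_top_tgt_I k u l (radiusGadgetEntry_ne_top_tgt_I W Q hv hlv).1 hl

/-- Hence the eccentricity of a vertex outside `I` is `⊤` (when `n ≥ 1`, so that `I` is nonempty).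
[folklore] -/
theorem weightedEccentricity_eq_top_of_le (hn : 0 < n) (u : Fin (4 * n + 1)) (hu : n ≤ (u : ℕ)) :
    weightedEccentricity (radiusGadget W Q) u = ⊤ := by
  refine le_antisymm le_top ?_
  have h : shortestDist (radiusGadget W Q) u (vI ⟨0, hn⟩) = ⊤ := by
    by_contra h
    have := lt_of_walkDistLE_ne_top_tgt_I (W := W) (Q := Q) _ u (vI ⟨0, hn⟩) hn h
    omega
  rw [← h]
  exact Finset.le_sup' (fun j => shortestDist (radiusGadget W Q) u j) (Finset.mem_univ _)

variable (hW : ∀ a b, |W a b| ≤ M) (hQ : 2 * M + 1 ≤ Q)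
include hW hQ

/-- **The distance from any `I`-vertex to `y` is at least `3Q - 1`** (every arc into `y` weighs
`3Q - 1`, prefixes are nonnegative). [folklore] -/
theorem le_shortestDist_y (u : Fin n) :
    ((3 * (Q : ℤ) - 1 : ℤ) : WithTop ℤ) ≤ shortestDist (radiusGadget W Q) (vI u) (vy n) := by
  refine le_walkDistLE_of_forall_arc_ge _ (radiusGadget_nonneg hW hQ) (fun l hl => ?_)
    (fun h => by have h' := congrArg Fin.val h; rw [vI_val, vy_val] at h'; omega)
  rw [radiusGadget_apply, vy_val] at hl ⊢
  rw [(radiusGadgetEntry_ne_top_tgt_y W Q hl).2]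

/-- Hence **every eccentricity is at least `3Q - 1`** (for `n ≥ 1`). [folklore] -/
theorem le_weightedEccentricity (hn : 0 < n) (u : Fin (4 * n + 1)) :
    ((3 * (Q : ℤ) - 1 : ℤ) : WithTop ℤ) ≤ weightedEccentricity (radiusGadget W Q) u := by
  by_cases hu : (u : ℕ) < n
  · have hue : u = vI ⟨u, hu⟩ := Fin.ext rfl
    rw [hue]
    exact (le_shortestDist_y hW hQ ⟨u, hu⟩).trans
      (Finset.le_sup' (fun j => shortestDist (radiusGadget W Q) (vI ⟨u, hu⟩) j) (Finset.mem_univ _))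
  · rw [weightedEccentricity_eq_top_of_le hn u (Nat.not_lt.1 hu)]
    exact le_top

/-- **The key lower bound** (AGV Lemma 2.3: "one shortest `s_I`-`s_L` path … has length `3Q`"
unless `s` lies on a negative triangle): if the distance from `i_I` to `i_L` is `< 3Q`, then `i` lies
on a negative triangle `i → u → v → i`. Proof: peel the last three arcs; the in-neighbour structure
and the bounds `arc ≥ Q - M`, `arc into I = 2Q`, `Q ≥ 2M + 1` leave only the walk
`i_I → u_J → v_K → i_L`. [cite: AbboudGrandoniVassilevskaWilliams2015, Lemma 2.3 (proof of Thm. 1.1)] -/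
theorem exists_negativeTriangle_of_shortestDist_lt {i : Fin n}
    (h : shortestDist (radiusGadget W Q) (vI i) (vL i) < ((3 * (Q : ℤ) : ℤ) : WithTop ℤ)) :
    ∃ u v : Fin n, i ≠ u ∧ u ≠ v ∧ v ≠ i ∧ W i u + W u v + W v i < 0 := by
  have hnn := radiusGadget_nonneg hW hQ
  have hwx : ∀ a b, -(M : ℤ) ≤ wx W a b ∧ wx W a b ≤ M := fun a b => abs_le.1 (abs_wx_le W hW a b)
  -- in-arcs of `I`-vertices are `2Q`: any finite optimum from `vI i` into `a_I ≠ vI i` is `≥ 2Q`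
  have hintoI : ∀ (k : ℕ) (l : Fin (4 * n + 1)), (l : ℕ) < n → vI i ≠ l →
      ((2 * (Q : ℤ) : ℤ) : WithTop ℤ) ≤ walkDistLE (radiusGadget W Q) k (vI i) l := by
    intro k l hl hsl
    refine le_walkDistLE_of_forall_arc_ge _ hnn (fun l' hl' => ?_) hsl
    rw [radiusGadget_apply] at hl' ⊢
    rw [(radiusGadgetEntry_ne_top_tgt_I W Q hl hl').2.2]
  have h' : walkDistLE (radiusGadget W Q) (Fintype.card (Fin (4 * n + 1))) (vI i) (vL i) <
      ((3 * (Q : ℤ) : ℤ) : WithTop ℤ) := h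
  have hsL : vI i ≠ vL i := fun e => by
    have := congrArg Fin.val e; rw [vI_val, vL_val] at this; omega
  -- peel the last arc: `l₂ → i_L`
  obtain ⟨k₂, -, l₂, he₂, hf₂, ha₂, -⟩ := exists_last_arc_of_walkDistLE_lt _ hnn h' hsL
  rw [he₂] at h'
  obtain ⟨p₂, hp₂⟩ := WithTop.ne_top_iff_exists.1 hf₂
  rw [radiusGadget_apply, vL_val] at ha₂
  rcases radiusGadgetEntry_ne_top_tgt_L W Q i.is_lt ha₂ with ⟨hl₂I, hl₂i, hw₂⟩ | ⟨v, hv, hl₂v, hvi, hw₂⟩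
  · -- `l₂ = u_I`, `u ≠ i`: the prefix is `≥ 2Q` but the total is `< 3Q` with the arc `2Q`
    exfalso
    have hsl₂ : vI i ≠ l₂ := fun e => hl₂i (by rw [← e, vI_val])
    have hlow := hintoI k₂ l₂ hl₂I hsl₂
    rw [radiusGadget_apply, vL_val, hw₂, ← hp₂, ← WithTop.coe_add, WithTop.coe_lt_coe] at h'
    rw [← hp₂, WithTop.coe_le_coe] at hlow
    omega
  · -- `l₂ = v_K`, `v ≠ i`, arc `Q + W v i`
    have hsl₂ : vI i ≠ l₂ := fun e => by
      have := congrArg Fin.val e; rw [vI_val, hl₂v] at this; omega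
    rw [radiusGadget_apply, vL_val, hw₂, ← hp₂, ← WithTop.coe_add, WithTop.coe_lt_coe] at h'
    -- peel the middle arc: `l₁ → v_K`, so `l₁ = u_J`, `u ≠ v`, arc `Q + W u v`
    have hlt₂ : walkDistLE (radiusGadget W Q) k₂ (vI i) l₂ < (((2 * (Q : ℤ) + M) : ℤ) : WithTop ℤ) := by
      rw [← hp₂, WithTop.coe_lt_coe]; have := (hwx v i).1; omega
    obtain ⟨k₁, -, l₁, he₁, hf₁, ha₁, -⟩ := exists_last_arc_of_walkDistLE_lt _ hnn hlt₂ hsl₂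
    obtain ⟨p₁, hp₁⟩ := WithTop.ne_top_iff_exists.1 hf₁
    rw [radiusGadget_apply, hl₂v] at ha₁
    obtain ⟨u, hu, hl₁u, huv, hw₁⟩ := radiusGadgetEntry_ne_top_tgt_K W Q hv ha₁
    have e₁ : p₁ + ((Q : ℤ) + wx W u v) = p₂ := by
      have := he₁
      rw [radiusGadget_apply, hl₂v, hw₁, ← hp₂, ← hp₁, ← WithTop.coe_add] at this
      exact (WithTop.coe_injective this).symm
    have hsl₁ : vI i ≠ l₁ := fun e => by
      have := congrArg Fin.val e; rw [vI_val, hl₁u] at this; omega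
    have hP₁ : p₁ < (Q : ℤ) + 2 * M := by have := (hwx v i).1; have := (hwx u v).1; omega
    -- peel the first arc: `l₀ → u_J`, so `l₀ = a_I`
    have hlt₁ : walkDistLE (radiusGadget W Q) k₁ (vI i) l₁ < ((((Q : ℤ) + 2 * M) : ℤ) : WithTop ℤ) := by
      rw [← hp₁, WithTop.coe_lt_coe]; have := (hwx v i).1; have := (hwx u v).1; omega
    obtain ⟨k₀, -, l₀, he₀, hf₀, ha₀, hp₀⟩ := exists_last_arc_of_walkDistLE_lt _ hnn hlt₁ hsl₁
    obtain ⟨p₀, hp₀e⟩ := WithTop.ne_top_iff_exists.1 hf₀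
    have hp₀nn : 0 ≤ p₀ := by
      rw [← hp₀e, ← WithTop.coe_zero, WithTop.coe_le_coe] at hp₀; exact hp₀
    rw [radiusGadget_apply, hl₁u] at ha₀
    obtain ⟨hl₀I, hcase⟩ := radiusGadgetEntry_ne_top_tgt_J W Q hu ha₀
    rcases hcase with ⟨hl₀u, hw₀⟩ | ⟨hl₀u, hw₀⟩
    · -- `l₀ = u_I`: arc `2Q`, so `p₀ + 2Q + (Q + W u v) < Q + 2M`: impossible
      exfalso
      have := he₀
      rw [radiusGadget_apply, hl₁u, hw₀, ← hp₁, ← hp₀e, ← WithTop.coe_add] at this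
      have e₀ := WithTop.coe_injective this
      rw [← hp₁, WithTop.coe_lt_coe] at hlt₁
      have := (hwx u v).1
      omega
    · -- `l₀ = a_I`, `a ≠ u`, arc `Q + W a u`; then `p₀ < 3M < 2Q` forces `l₀ = vI i`
      have e₀ : p₀ + ((Q : ℤ) + wx W l₀ u) = p₁ := by
        have := he₀
        rw [radiusGadget_apply, hl₁u, hw₀, ← hp₁, ← hp₀e, ← WithTop.coe_add] at this
        exact (WithTop.coe_injective this).symm
      have hl₀i : (l₀ : ℕ) = i := by
        by_contra hne
        have hlow := hintoI k₀ l₀ hl₀I (fun e => hne (by rw [← e, vI_val]))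
        rw [← hp₀e, WithTop.coe_le_coe] at hlow
        have := (hwx l₀ u).1; have := (hwx u v).1
        omega
      rw [hl₀i] at e₀ hl₀u
      -- the triangle `i → u → v → i`
      refine ⟨⟨u, hu⟩, ⟨v, hv⟩, fun e => hl₀u (congrArg Fin.val e), fun e => huv (congrArg Fin.val e),
        fun e => hvi (congrArg Fin.val e), ?_⟩
      have q₁ : W i ⟨u, hu⟩ = wx W i u := (wx_mk W i.is_lt hu).symm
      have q₂ : W ⟨u, hu⟩ ⟨v, hv⟩ = wx W u v := (wx_mk W hu hv).symm
      have q₃ : W ⟨v, hv⟩ i = wx W v i := (wx_mk W hv i.is_lt).symm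
      rw [q₁, q₂, q₃]
      omega

/-! #### Upper bounds: explicit short walks -/

omit hW hQ in
/-- One arc: `d(u, t) ≤ G u t`. [folklore] -/
theorem shortestDist_le_arc (u t : Fin (4 * n + 1)) :
    shortestDist (radiusGadget W Q) u t ≤ radiusGadget W Q u t := by
  have hcard : 1 ≤ Fintype.card (Fin (4 * n + 1)) := by rw [Fintype.card_fin]; omega
  refine (shortestDist_le_of_le_holds _ hcard u t).trans ?_
  refine (walkDistLE_succ_le_add _ 0 u u t).trans ?_
  rw [walkDistLE_zero_apply, if_pos rfl, zero_add]

omit hW hQ in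
/-- Two arcs through `l`: `d(u, t) ≤ G u l + G l t` (`n ≥ 1`). [folklore] -/
theorem shortestDist_le_arc_arc (hn : 0 < n) (u l t : Fin (4 * n + 1)) :
    shortestDist (radiusGadget W Q) u t ≤ radiusGadget W Q u l + radiusGadget W Q l t := by
  have hcard : 2 ≤ Fintype.card (Fin (4 * n + 1)) := by rw [Fintype.card_fin]; omega
  refine (shortestDist_le_of_le_holds _ hcard u t).trans ?_
  refine (walkDistLE_succ_le_add _ 1 u l t).trans (add_le_add ?_ le_rfl)
  refine (walkDistLE_succ_le_add _ 0 u u l).trans ?_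
  rw [walkDistLE_zero_apply, if_pos rfl, zero_add]

omit hW hQ in
/-- Three arcs through `l, l'`: `d(u, t) ≤ G u l + G l l' + G l' t` (`n ≥ 1`). [folklore] -/
theorem shortestDist_le_arc_arc_arc (hn : 0 < n) (u l l' t : Fin (4 * n + 1)) :
    shortestDist (radiusGadget W Q) u t ≤
      radiusGadget W Q u l + radiusGadget W Q l l' + radiusGadget W Q l' t := by
  have hcard : 3 ≤ Fintype.card (Fin (4 * n + 1)) := by rw [Fintype.card_fin]; omega
  refine (shortestDist_le_of_le_holds _ hcard u t).trans ?_
  refine (walkDistLE_succ_le_add _ 2 u l' t).trans (add_le_add ?_ le_rfl)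
  refine (walkDistLE_succ_le_add _ 1 u l l').trans (add_le_add ?_ le_rfl)
  refine (walkDistLE_succ_le_add _ 0 u u l).trans ?_
  rw [walkDistLE_zero_apply, if_pos rfl, zero_add]

/-- **If `i` lies on a negative triangle, every vertex is within `3Q - 1` of `i_I`** (AGV Lemma 2.3:
"any node `s_I` is at distance at most `2Q` to nodes in … `J ∪ (L - {s_L})`, at most `2Q + 2M` to
nodes in `K` …, and exactly `3Q - 1` to node `y`", and `s_L` through the triangle).
[cite: AbboudGrandoniVassilevskaWilliams2015, Lemma 2.3 (proof of Thm. 1.1)] -/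
theorem shortestDist_le_of_negativeTriangle {i j k : Fin n} (hij : i ≠ j) (hjk : j ≠ k) (hki : k ≠ i)
    (hneg : W i j + W j k + W k i < 0) (t : Fin (4 * n + 1)) :
    shortestDist (radiusGadget W Q) (vI i) t ≤ ((3 * (Q : ℤ) - 1 : ℤ) : WithTop ℤ) := by
  have hn : 0 < n := i.pos
  have hM : ∀ a b, -(M : ℤ) ≤ W a b ∧ W a b ≤ M := fun a b => abs_le.1 (hW a b)
  rcases gadgetVertex_cases t with ⟨a, rfl⟩ | ⟨a, rfl⟩ | ⟨a, rfl⟩ | ⟨a, rfl⟩ | rfl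
  · -- `t = a_I`
    by_cases hia : i = a
    · subst hia
      rw [hasNoNegativeCycle_radiusGadget hW hQ (vI i), ← WithTop.coe_zero]
      exact WithTop.coe_le_coe.2 (by omega)
    · refine (shortestDist_le_arc (vI i) (vI a)).trans ?_
      rw [radiusGadget_II W Q hia]
      exact WithTop.coe_le_coe.2 (by omega)
  · -- `t = a_J`
    refine (shortestDist_le_arc (vI i) (vJ a)).trans ?_
    by_cases hia : i = a
    · subst hia
      rw [radiusGadget_IJ_self W Q i]
      exact WithTop.coe_le_coe.2 (by omega)
    · rw [radiusGadget_IJ W Q hia]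
      have := (hM i a).2
      exact WithTop.coe_le_coe.2 (by omega)
  · -- `t = a_K`: through `u_J` with `u ∉ {i, a}` (one of `j, k` qualifies)
    obtain ⟨u, hui, hua⟩ : ∃ u : Fin n, i ≠ u ∧ u ≠ a := by
      by_cases hja : j = a
      · exact ⟨k, Ne.symm hki, fun h => hjk (hja.trans h.symm)⟩
      · exact ⟨j, hij, hja⟩
    refine (shortestDist_le_arc_arc hn (vI i) (vJ u) (vK a)).trans ?_
    rw [radiusGadget_IJ W Q hui, radiusGadget_JK W Q hua, ← WithTop.coe_add]
    have := (hM i u).2; have := (hM u a).2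
    exact WithTop.coe_le_coe.2 (by omega)
  · -- `t = a_L`
    by_cases hia : i = a
    · -- `i_L` through the negative triangle
      subst hia
      refine (shortestDist_le_arc_arc_arc hn (vI i) (vJ j) (vK k) (vL i)).trans ?_
      rw [radiusGadget_IJ W Q hij, radiusGadget_JK W Q hjk, radiusGadget_KL W Q hki,
        ← WithTop.coe_add, ← WithTop.coe_add]
      exact WithTop.coe_le_coe.2 (by omega)
    · refine (shortestDist_le_arc (vI i) (vL a)).trans ?_
      rw [radiusGadget_IL W Q hia]
      exact WithTop.coe_le_coe.2 (by omega)
  · -- `t = y`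
    refine (shortestDist_le_arc (vI i) (vy n)).trans ?_
    rw [radiusGadget_Iy W Q i]

/-! ### The radius -/

/-- **The radius of the gadget detects negative triangles** (Abboud–Grandoni–Vassilevska Williams,
SODA 2015, Lemma 2.3 / proof of Thm. 1.1: "the center of the graph belongs to `I`, and … the
corresponding radius is upper bounded by `3Q - 1` if and only if there exists a negative triangle";
here, all eccentricities being `≥ 3Q - 1`, as an equality): for `|W| ≤ M` and `2M + 1 ≤ Q`,
`weightedRadius (radiusGadget W Q) = 3Q - 1 ↔ HasNegativeTriangle W`.
[cite: AbboudGrandoniVassilevskaWilliams2015, Lemma 2.3 (proof of Thm. 1.1)] -/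
theorem weightedRadius_radiusGadget_eq_iff :
    weightedRadius (radiusGadget W Q) = ((3 * (Q : ℤ) - 1 : ℤ) : WithTop ℤ) ↔ HasNegativeTriangle W := by
  rcases Nat.eq_zero_or_pos n with hn0 | hn
  · -- `n = 0`: the single vertex `y`, radius `0 ≠ 3Q - 1`
    subst hn0
    constructor
    · intro h
      exfalso
      have hy : ∀ u v : Fin (4 * 0 + 1), u = v := fun u v => Fin.ext (by omega)
      have hdiag := hasNoNegativeCycle_radiusGadget hW hQ (vy 0)
      have hecc : weightedEccentricity (radiusGadget W Q) (vy 0) = 0 := by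
        refine le_antisymm (Finset.sup'_le _ _ fun j _ => ?_) ?_
        · rw [hy j (vy 0), hdiag]
        · refine le_trans (le_of_eq hdiag.symm) ?_
          exact Finset.le_sup' (fun j => shortestDist (radiusGadget W Q) (vy 0) j) (Finset.mem_univ _)
      have hrad : weightedRadius (radiusGadget W Q) = 0 := by
        refine le_antisymm ((Finset.inf_le (Finset.mem_univ (vy 0))).trans hecc.le) ?_
        exact Finset.le_inf fun u _ => by rw [hy u (vy 0), hecc]
      rw [hrad, ← WithTop.coe_zero, WithTop.coe_eq_coe] at h
      omega
    · rintro ⟨i, -⟩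
      exact i.elim0
  constructor
  · -- a centre of eccentricity `3Q - 1` is some `i_I`, and then `d(i_I, i_L) ≤ 3Q - 1 < 3Q`
    intro h
    obtain ⟨u, -, hu⟩ := Finset.exists_mem_eq_inf (Finset.univ : Finset (Fin (4 * n + 1)))
      ⟨vy n, Finset.mem_univ _⟩ (fun u => weightedEccentricity (radiusGadget W Q) u)
    change weightedRadius (radiusGadget W Q) = weightedEccentricity (radiusGadget W Q) u at hu
    rw [h] at hu
    have huI : (u : ℕ) < n := by
      by_contra huI
      rw [weightedEccentricity_eq_top_of_le hn u (Nat.not_lt.1 huI)] at hu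
      exact WithTop.coe_ne_top hu
    set i : Fin n := ⟨u, huI⟩ with hi
    have hus : u = vI i := Fin.ext rfl
    have hd : shortestDist (radiusGadget W Q) u (vL i) ≤ weightedEccentricity (radiusGadget W Q) u :=
      Finset.le_sup' (fun j => shortestDist (radiusGadget W Q) u j) (Finset.mem_univ _)
    rw [← hu, hus] at hd
    have hd' : shortestDist (radiusGadget W Q) (vI i) (vL i) < ((3 * (Q : ℤ) : ℤ) : WithTop ℤ) :=
      lt_of_le_of_lt hd (WithTop.coe_lt_coe.2 (by omega))
    obtain ⟨v, w, hiv, hvw, hwi, hneg⟩ := exists_negativeTriangle_of_shortestDist_lt hW hQ hd'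
    exact ⟨i, v, w, hiv, hvw, Ne.symm hwi, hneg⟩
  · -- a negative triangle through `i` makes `ecc(i_I) ≤ 3Q - 1`, all eccentricities being `≥ 3Q - 1`
    rintro ⟨i, j, k, hij, hjk, hik, hneg⟩
    have hle : weightedEccentricity (radiusGadget W Q) (vI i) ≤ ((3 * (Q : ℤ) - 1 : ℤ) : WithTop ℤ) :=
      Finset.sup'_le _ _ fun t _ =>
        shortestDist_le_of_negativeTriangle hW hQ hij hjk (Ne.symm hik) hneg t
    refine le_antisymm ((Finset.inf_le (Finset.mem_univ _)).trans hle) ?_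
    exact Finset.le_inf fun u _ => le_weightedEccentricity hW hQ hn u

end Distances

end Literature.Computability.Cryptography
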